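import Summits.NavierStokesRegularity.NavierStokesRegularity.Theorems.SwirlFreeBudgetEtaReverseHolderStep
import Mathlib.MeasureTheory.Integral.DominatedConvergence
import HarnessLib

/-!
# SwirlFreeBudget, crux K-18.1 `EtaMoserBound`, step A.5: the reverse Hölder inequality for the
# scalar family `f = ω_θ/r` on axis-centred parabolic cylinders (seat nsreg-p4 g13)

Support file for the DORMANT route `SwirlThreshold` (crux stmt-NavierStokesRegularity-2002) and
planner nsreg-p2's ROUND-18 Appendix A (`R18-APPENDIX-EtaMoser.md`, (A.5) = Chen–Tsai–Zhang 2022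
(eqA.6) with `Γ ↦ η`).  For the abstract `η`-family of the siblings (a field `W` and a scalar
family `f` on `]lo, hi[`, globally smooth axisymmetric slices, `W` divergence free on an open
`U`, the classical equation `∂ₜf = Δf − Df[W] + 2 radDerivQuot f` at the points of `U`) and an
axis point `c` with `B̄(c, ϱ') ⊆ U`, `R₂/2 ≤ ϱ < ϱ' ≤ R₂`, `∫_{B̄(c,ϱ')} |W(s)|² ≤ w̄` on
`]t₁ − ϱ'², t₁[`, and real `m ≥ 1`:

* `eta_reverseHolder_core` —
  `∬_{Q((t₁,c),ϱ)} |f|^{10m/3} ≤ 5 C_S² (K′ ∬_{Q((t₁,c),ϱ')} |f|^{2m})^{5/3}`,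
  `K′ = (72C₁² + 68C_T)/(ϱ'−ϱ)² + 27648 C₁⁴ C_S⁶ w̄²/(ϱ'−ϱ)⁴`
  (the fixed-`λ` step `eta_reverseHolder_lambda` for the profiles `H_λ = (λ² + f²)^m` and the
  cut-offs of `…SwirlFreeBudgetEtaProfiles` at the intermediate radius `ϱ'' = (ϱ+ϱ')/2`, then
  `λ → 0⁺` by dominated convergence).

WHAT THIS IS NOT: not NS regularity — an estimate for the smooth swirl-free class; `EtaMoserBound`
stays OPEN here; no crux claim.
-/

-- the problem directory repeats the summit name (D-0017); core's `dupNamespace` linter fires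
set_option linter.dupNamespace false

namespace Summit.NavierStokesRegularity.NavierStokesRegularity.Theorems.SwirlFreeBudget

open MeasureTheory Set Filter Topology Metric Function intervalIntegral
open scoped RealInnerProductSpace Laplacian ContDiff ENNReal NNReal
open Literature.Analysis Literature.Analysis.FluidPDE Literature.Analysis.FluidPDE.Seregin2020

noncomputable section

section Core

variable {W : ℝ → EuclideanSpace ℝ (Fin 3) → EuclideanSpace ℝ (Fin 3)}
  {f : ℝ → EuclideanSpace ℝ (Fin 3) → ℝ} {lo hi : ℝ}

/-- **`λ → 0⁺` in the regularised masses**: for `g` continuous on a compact `C ⊇ S`,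
`∫_S (λ² + g²)^m → ∫_S |g|^{2m}` (dominated convergence with the bound `(1 + g²)^m`). -/
theorem tendsto_setIntegral_etaProfile {g : ℝ × EuclideanSpace ℝ (Fin 3) → ℝ}
    {S C : Set (ℝ × EuclideanSpace ℝ (Fin 3))} (hSC : S ⊆ C) (hC : IsCompact C) (hS : MeasurableSet S)
    (hg : ContinuousOn g C) {m : ℝ} (hm : 1 ≤ m) :
    Tendsto (fun lam : ℝ => ∫ p in S, (lam ^ 2 + g p ^ 2) ^ m ∂(volume : Measure (ℝ × EuclideanSpace ℝ (Fin 3))))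
      (𝓝[>] 0) (𝓝 (∫ p in S, |g p| ^ (2 * m) ∂(volume : Measure (ℝ × EuclideanSpace ℝ (Fin 3))))) := by
  have hm0 : 0 ≤ m := le_trans zero_le_one hm
  have hbound : IntegrableOn (fun p => (1 + g p ^ 2) ^ m) S (volume : Measure (ℝ × EuclideanSpace ℝ (Fin 3))) := by
    have hc : ContinuousOn (fun p => (1 + g p ^ 2) ^ m) C :=
      (continuousOn_const.add (hg.pow 2)).rpow_const fun p _ => Or.inr hm0
    exact (hc.integrableOn_compact hC).mono_set hSC
  refine tendsto_integral_filter_of_dominated_convergence (fun p => (1 + g p ^ 2) ^ m) ?_ ?_ hbound ?_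
  · filter_upwards [self_mem_nhdsWithin] with lam _
    have hc : ContinuousOn (fun p => (lam ^ 2 + g p ^ 2) ^ m) C :=
      (continuousOn_const.add (hg.pow 2)).rpow_const fun p _ => Or.inr hm0
    exact (hc.mono hSC).aestronglyMeasurable hS
  · filter_upwards [Ioo_mem_nhdsGT (zero_lt_one' ℝ)] with lam hlam
    refine ae_of_all _ fun p => ?_
    have hu : 0 ≤ lam ^ 2 + g p ^ 2 := add_nonneg (sq_nonneg _) (sq_nonneg _)
    rw [Real.norm_of_nonneg (Real.rpow_nonneg hu _)]
    exact Real.rpow_le_rpow hu (add_le_add_left (pow_le_one₀ hlam.1.le hlam.2.le) _) hm0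
  · exact ae_of_all _ fun p => (tendsto_etaProfile hm (g p)).mono_left nhdsWithin_le_nhds

set_option maxHeartbeats 400000 in
/-- **The reverse Hölder inequality for the `η`-family, core form** (memo (A.5); CTZ22 (eqA.6)
with `Γ ↦ η`).  In the abstract setting of `eta_tenThirds_le` (the field `W` and the scalar family
`f` on `]lo, hi[`; `W` divergence free on the open `U`), let `c` be an axis point, `m ≥ 1`,
`0 < R₂`, `R₂/2 ≤ ϱ < ϱ' ≤ R₂`, `B̄(c, ϱ') ⊆ U`, `lo < t₁ − ϱ'²`, `t₁ < hi`, and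
`∫_{B̄(c,ϱ')} ‖W(s)‖² ≤ w̄` for `s ∈ ]t₁ − ϱ'², t₁[`.  Then, with the absolute constants `C_T`
(`|smoothTransition'| ≤ C_T`), `C₁` (the gradient bound of `radialCutoff`), `C_S` (Sobolev),
`∬_{]t₁−ϱ²,t₁[×B(c,ϱ)} |f|^{10m/3} ≤ 5 C_S² (K′ ∬_{]t₁−ϱ'²,t₁[×B(c,ϱ')} |f|^{2m})^{5/3}`,
`K′ = (72C₁² + 68C_T)/(ϱ'−ϱ)² + 27648 C₁⁴ C_S⁶ w̄²/(ϱ'−ϱ)⁴`. -/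
theorem eta_reverseHolder_core
    (hf : ∀ τ ∈ Ioo lo hi, ContDiff ℝ 2 (f τ)) (hfax : ∀ τ ∈ Ioo lo hi, IsAxisymmetricScalar (f τ))
    (hW : ∀ τ ∈ Ioo lo hi, ContDiff ℝ 1 (W τ))
    {U : Set (EuclideanSpace ℝ (Fin 3))}
    (hdiv : ∀ τ ∈ Ioo lo hi, ∀ x ∈ U, VectorCalculus.divergence (W τ) x = 0)
    (hfc : ContinuousOn (fun p : ℝ × EuclideanSpace ℝ (Fin 3) => f p.1 p.2) (Ioo lo hi ×ˢ univ))
    (hDc : ContinuousOn (fun p : ℝ × EuclideanSpace ℝ (Fin 3) => fderiv ℝ (f p.1) p.2) (Ioo lo hi ×ˢ univ))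
    (hqfc : ContinuousOn (fun p : ℝ × EuclideanSpace ℝ (Fin 3) => radDerivQuot (f p.1) p.2) (Ioo lo hi ×ˢ univ))
    (hWc : ContinuousOn (fun p : ℝ × EuclideanSpace ℝ (Fin 3) => W p.1 p.2) (Ioo lo hi ×ˢ univ))
    (hLc : ContinuousOn (fun p : ℝ × EuclideanSpace ℝ (Fin 3) =>
      (Δ (f p.1)) p.2 - fderiv ℝ (f p.1) p.2 (W p.1 p.2) + 2 * radDerivQuot (f p.1) p.2) (Ioo lo hi ×ˢ univ))
    (heq : ∀ x ∈ U, ∀ s ∈ Ioo lo hi, ∀ t ∈ Ioo lo hi, s ≤ t →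
      f t x - f s x = ∫ τ in s..t, ((Δ (f τ)) x - fderiv ℝ (f τ) x (W τ x) + 2 * radDerivQuot (f τ) x))
    {c : EuclideanSpace ℝ (Fin 3)} (hc : c 0 = 0 ∧ c 1 = 0)
    {m : ℝ} (hm : 1 ≤ m) {R₂ ϱ ϱ' t₁ : ℝ} (hR₂ : 0 < R₂) (hϱ : R₂ / 2 ≤ ϱ) (hϱϱ' : ϱ < ϱ') (hϱ'R : ϱ' ≤ R₂)
    (hU : closedBall c ϱ' ⊆ U) (hlo : lo < t₁ - ϱ' ^ 2) (hhi : t₁ < hi)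
    {CT : ℝ} (hCT : ∀ t, |deriv Real.smoothTransition t| ≤ CT)
    {C₁ : ℝ} (hC₁0 : 0 ≤ C₁) (hC₁ : ∀ (ρ₂ ρ₁ : ℝ), 0 ≤ ρ₂ → ρ₂ < ρ₁ → ∀ z : EuclideanSpace ℝ (Fin 3),
      ‖gradient (radialCutoff ρ₂ ρ₁ : EuclideanSpace ℝ (Fin 3) → ℝ) z‖ ≤ C₁ / (ρ₁ - ρ₂))
    {wbar : ℝ} (hwbar : ∀ s ∈ Ioo (t₁ - ϱ' ^ 2) t₁, ∫ x in closedBall c ϱ', ‖W s x‖ ^ 2 ≤ wbar) :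
    ∫⁻ p in Ioo (t₁ - ϱ ^ 2) t₁ ×ˢ ball c ϱ, ‖f p.1 p.2‖ₑ ^ (10 * m / 3 : ℝ)
        ∂(volume : Measure (ℝ × EuclideanSpace ℝ (Fin 3))) ≤
      ENNReal.ofReal (5 * (SNormLESNormFDerivOfEqConst ℝ (volume : Measure (EuclideanSpace ℝ (Fin 3))) 2 : ℝ) ^ 2 *
        (((72 * C₁ ^ 2 + 68 * CT) / (ϱ' - ϱ) ^ 2 + 27648 * C₁ ^ 4 *
            (SNormLESNormFDerivOfEqConst ℝ (volume : Measure (EuclideanSpace ℝ (Fin 3))) 2 : ℝ) ^ 6 *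
            wbar ^ 2 / (ϱ' - ϱ) ^ 4) *
          ∫ p in Ioo (t₁ - ϱ' ^ 2) t₁ ×ˢ ball c ϱ', |f p.1 p.2| ^ (2 * m)
            ∂(volume : Measure (ℝ × EuclideanSpace ℝ (Fin 3)))) ^ (5 / 3 : ℝ)) := by
  -- ## constants, radii, times (opaque names)
  obtain ⟨CS, hCS⟩ : ∃ CS : ℝ, CS = (SNormLESNormFDerivOfEqConst ℝ (volume : Measure (EuclideanSpace ℝ (Fin 3))) 2 : ℝ) :=
    ⟨_, rfl⟩
  obtain ⟨Kp, hKp⟩ : ∃ Kp : ℝ, Kp = (72 * C₁ ^ 2 + 68 * CT) / (ϱ' - ϱ) ^ 2 +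
      27648 * C₁ ^ 4 * CS ^ 6 * wbar ^ 2 / (ϱ' - ϱ) ^ 4 := ⟨_, rfl⟩
  rw [← hCS, ← hKp]
  have hCT0 : 0 ≤ CT := (abs_nonneg _).trans (hCT 0)
  obtain ⟨d, hd⟩ : ∃ d : ℝ, d = ϱ' - ϱ := ⟨_, rfl⟩
  have hd0 : 0 < d := by rw [hd]; linarith
  have hϱ0 : 0 ≤ ϱ := by linarith
  obtain ⟨ϱ₁, hϱ₁⟩ : ∃ ϱ₁ : ℝ, ϱ₁ = ϱ + d / 2 := ⟨_, rfl⟩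
  have hϱϱ₁ : ϱ < ϱ₁ := by rw [hϱ₁]; linarith
  have hϱ₁ϱ' : ϱ₁ < ϱ' := by rw [hϱ₁, hd]; linarith
  have hgap : d ^ 2 / 4 ≤ ϱ₁ ^ 2 - ϱ ^ 2 := by rw [hϱ₁]; nlinarith
  have hgap0 : 0 < ϱ₁ ^ 2 - ϱ ^ 2 := lt_of_lt_of_le (by positivity) hgap
  have hinvgap : (ϱ₁ ^ 2 - ϱ ^ 2)⁻¹ ≤ 4 / d ^ 2 := by
    rw [inv_le_comm₀ hgap0 (by positivity), inv_div]
    exact hgap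
  have hϱsq : ϱ ^ 2 ≤ ϱ₁ ^ 2 := by nlinarith
  have hϱ₁sq : ϱ₁ ^ 2 ≤ ϱ' ^ 2 := by nlinarith
  have ht₁a : t₁ - ϱ' ^ 2 < t₁ := by nlinarith
  obtain ⟨T₀, hT₀⟩ : ∃ T₀ : ℝ, T₀ = t₁ - ϱ₁ ^ 2 := ⟨_, rfl⟩
  have hT₀lo : lo < T₀ := by rw [hT₀]; linarith
  have hT₀t₁ : T₀ < t₁ := by rw [hT₀]; nlinarith
  have hT₀a : T₀ ≤ t₁ - ϱ ^ 2 := by rw [hT₀]; linarith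
  have hT₀b' : t₁ - ϱ' ^ 2 < T₀ := by rw [hT₀]; nlinarith
  have hT₀b : t₁ - ϱ' ^ 2 ≤ T₀ := hT₀b'.le
  have hK : IsCompact (closedBall c ϱ₁) := isCompact_closedBall _ _
  have hKU : closedBall c ϱ₁ ⊆ U := (closedBall_subset_closedBall hϱ₁ϱ'.le).trans hU
  have hKball : closedBall c ϱ₁ ⊆ ball c ϱ' := closedBall_subset_ball hϱ₁ϱ'
  -- ## the cut-offs
  obtain ⟨B, hB⟩ : ∃ B : ℝ, B = C₁ / (ϱ₁ - ϱ) := ⟨_, rfl⟩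
  have hB0 : 0 ≤ B := by rw [hB]; exact div_nonneg hC₁0 (by linarith)
  have hBeq : B = 2 * C₁ / d := by
    rw [hB, hϱ₁, show ϱ + d / 2 - ϱ = d / 2 by ring, div_div_eq_mul_div]
    ring
  obtain ⟨Q, hQ⟩ : ∃ Q : ℝ, Q = 32 * CT / d ^ 2 := ⟨_, rfl⟩
  obtain ⟨ψ, hψdef⟩ : ∃ ψ : EuclideanSpace ℝ (Fin 3) → ℝ, ∀ x, ψ x = radialCutoff ϱ ϱ₁ (x - c) := ⟨_, fun _ => rfl⟩
  obtain ⟨Θ, hΘdef⟩ : ∃ Θ : EuclideanSpace ℝ (Fin 3) → ℝ, ∀ x, Θ x = ψ x ^ 2 := ⟨_, fun _ => rfl⟩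
  obtain ⟨q, hqdef⟩ : ∃ q : EuclideanSpace ℝ (Fin 3) → ℝ, ∀ x, q x = -8 * (ϱ₁ ^ 2 - ϱ ^ 2)⁻¹ * ψ x ^ 3 *
      deriv Real.smoothTransition ((ϱ₁ ^ 2 - ϱ ^ 2)⁻¹ * (ϱ₁ ^ 2 - ‖x - c‖ ^ 2)) := ⟨_, fun _ => rfl⟩
  obtain ⟨hψC, hψ0, hψ1, hψone, hψsupp, hgradψ, -, hΘax, hqax, hqc, hq0, hqb, hqrad⟩ :=
    etaSpaceCutoff_props hc hϱ0 hϱϱ₁ hCT hC₁ hψdef hΘdef hqdef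
  have hgradψ' : ∀ x, ‖gradient ψ x‖ ≤ B := fun x => by rw [hB]; exact hgradψ x
  have hQb : ∀ x, |q x| ≤ Q := fun x => (hqb x).trans (by
    rw [hQ]
    calc 8 * CT * (ϱ₁ ^ 2 - ϱ ^ 2)⁻¹ ≤ 8 * CT * (4 / d ^ 2) := mul_le_mul_of_nonneg_left hinvgap (by positivity)
      _ = 32 * CT / d ^ 2 := by ring)
  obtain ⟨χ, hχdef⟩ : ∃ χ : ℝ → ℝ, ∀ s, χ s = Real.smoothTransition (((s - t₁) + ϱ₁ ^ 2) / (ϱ₁ ^ 2 - ϱ ^ 2)) :=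
    ⟨_, fun _ => rfl⟩
  obtain ⟨hχC, hχT₀', hχone, hχ01, hχ'⟩ := etaTimeCutoff_props (t₁ := t₁) hϱ0 hϱϱ₁ hCT hχdef
  have hχT₀ : χ T₀ = 0 := by rw [hT₀]; exact hχT₀'
  obtain ⟨χt, hχt⟩ : ∃ χt : ℝ → ℝ, ∀ s, χt s = Real.sqrt (χ s) := ⟨_, fun _ => rfl⟩
  have hχt0 : ∀ s, 0 ≤ χt s := fun s => by rw [hχt]; exact Real.sqrt_nonneg _
  have hχχt : ∀ s, χ s = χt s ^ 2 := fun s => by rw [hχt]; exact (Real.sq_sqrt (hχ01 s).1).symm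
  have hχ'b : ∀ s, |deriv χ s| ≤ 4 * CT / d ^ 2 := fun s => (hχ' s).trans (by
    rw [div_eq_mul_inv]
    calc CT * (ϱ₁ ^ 2 - ϱ ^ 2)⁻¹ ≤ CT * (4 / d ^ 2) := mul_le_mul_of_nonneg_left hinvgap hCT0
      _ = 4 * CT / d ^ 2 := by ring)
  -- ## the slice energy bound on `[T₀, t₁]` for `B̄(c, ϱ₁)`
  have hwbar_t₁ : ∫ x in closedBall c ϱ', ‖W t₁ x‖ ^ 2 ≤ wbar :=
    sliceEnergy_le_of_Ico hWc (isCompact_closedBall c ϱ') hT₀lo hT₀t₁ hhi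
      fun s hs => hwbar s ⟨hT₀b'.trans_le hs.1, hs.2⟩
  have hwbarK : ∀ s ∈ Icc T₀ t₁, ∫ x in closedBall c ϱ₁, ‖W s x‖ ^ 2 ≤ wbar := by
    intro s hs
    have hsI : s ∈ Ioo lo hi := ⟨hT₀lo.trans_le hs.1, lt_of_le_of_lt hs.2 hhi⟩
    have hbig : ∫ x in closedBall c ϱ', ‖W s x‖ ^ 2 ≤ wbar := by
      rcases eq_or_lt_of_le hs.2 with h | h
      · rw [h]; exact hwbar_t₁
      · exact hwbar s ⟨hT₀b'.trans_le hs.1, h⟩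
    refine le_trans (setIntegral_mono_set ?_ (ae_of_all _ fun x => sq_nonneg _)
      (ae_of_all _ (closedBall_subset_closedBall hϱ₁ϱ'.le))) hbig
    exact ((hW s hsI).continuous.norm.pow 2).continuousOn.integrableOn_compact (isCompact_closedBall _ _)
  -- ## the constant
  have hKp0 : 0 ≤ Kp := by rw [hKp]; positivity
  have hKp_ge : 18 * B ^ 2 + 1728 * B ^ 4 * CS ^ 6 * wbar ^ 2 + 2 * Q + 4 * CT / d ^ 2 ≤ Kp := by
    have e : 18 * B ^ 2 + 1728 * B ^ 4 * CS ^ 6 * wbar ^ 2 + 2 * Q + 4 * CT / d ^ 2 = Kp := by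
      rw [hKp, hBeq, hQ, hd]
      field_simp
      ring
    exact e.le
  -- ## Step 1: the estimate for every `λ ∈ (0, 1]`
  obtain ⟨J, hJ⟩ : ∃ J : ℝ → ℝ, ∀ lam, J lam =
      ∫ p in Ioo (t₁ - ϱ' ^ 2) t₁ ×ˢ ball c ϱ', (lam ^ 2 + f p.1 p.2 ^ 2) ^ m
        ∂(volume : Measure (ℝ × EuclideanSpace ℝ (Fin 3))) := ⟨_, fun _ => rfl⟩
  have hstep : ∀ lam : ℝ, 0 < lam →
      ∫⁻ p in Ioo (t₁ - ϱ ^ 2) t₁ ×ˢ ball c ϱ, ‖f p.1 p.2‖ₑ ^ (10 * m / 3 : ℝ)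
          ∂(volume : Measure (ℝ × EuclideanSpace ℝ (Fin 3))) ≤
        ENNReal.ofReal (5 * CS ^ 2 * (Kp * J lam) ^ (5 / 3 : ℝ)) := by
    intro lam hlam
    obtain ⟨sf, hsfdef⟩ : ∃ sf : ℝ → ℝ, ∀ v, sf v = (lam ^ 2 + v ^ 2) ^ (m / 2) := ⟨_, fun _ => rfl⟩
    obtain ⟨H, hHdef⟩ : ∃ H : ℝ → ℝ, ∀ v, H v = (lam ^ 2 + v ^ 2) ^ m := ⟨_, fun _ => rfl⟩
    obtain ⟨hsfC, hHC, hsf0, hHs, hs2, hκ, hsfge, -⟩ := etaProfile_props hm hlam hsfdef hHdef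
    have h := eta_reverseHolder_lambda hf hfax hW hdiv hfc hDc hqfc hWc hLc heq hm hHC hsfC hsf0 hHs hs2 hκ hsfge
      hψC hψ0 hψ1 hΘdef hΘax hB0 hgradψ' hK hψsupp hKU hqc hq0 hqax hQb hqrad hχC hχχt hχt0 hχ01 hχ'b
      hT₀lo hT₀t₁ hhi hχT₀ hwbarK hT₀a hχone hψone hT₀b hKball hlo hKp0 (by rw [← hCS]; exact hKp_ge)
    have eJ : (∫ p in Ioo (t₁ - ϱ' ^ 2) t₁ ×ˢ ball c ϱ', H (f p.1 p.2)
        ∂(volume : Measure (ℝ × EuclideanSpace ℝ (Fin 3)))) = J lam := by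
      rw [hJ lam]
      exact setIntegral_congr_fun (measurableSet_Ioo.prod measurableSet_ball) fun p _ => hHdef _
    rw [← hCS, eJ] at h
    exact h
  -- ## Step 2: `λ → 0⁺` by dominated convergence
  have hboxI : Icc (t₁ - ϱ' ^ 2) t₁ ×ˢ closedBall c ϱ' ⊆ Ioo lo hi ×ˢ (univ : Set (EuclideanSpace ℝ (Fin 3))) :=
    prod_mono (fun r hr => ⟨hlo.trans_le hr.1, lt_of_le_of_lt hr.2 hhi⟩) (subset_univ _)
  have hJlim : Tendsto J (𝓝[>] 0)
      (𝓝 (∫ p in Ioo (t₁ - ϱ' ^ 2) t₁ ×ˢ ball c ϱ', |f p.1 p.2| ^ (2 * m)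
        ∂(volume : Measure (ℝ × EuclideanSpace ℝ (Fin 3))))) := by
    have hJfun : J = fun lam => ∫ p in Ioo (t₁ - ϱ' ^ 2) t₁ ×ˢ ball c ϱ', (lam ^ 2 + f p.1 p.2 ^ 2) ^ m
        ∂(volume : Measure (ℝ × EuclideanSpace ℝ (Fin 3))) := funext hJ
    rw [hJfun]
    exact tendsto_setIntegral_etaProfile (g := fun p : ℝ × EuclideanSpace ℝ (Fin 3) => f p.1 p.2)
      (prod_mono Ioo_subset_Icc_self ball_subset_closedBall) (isCompact_Icc.prod (isCompact_closedBall _ _))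
      (measurableSet_Ioo.prod measurableSet_ball) (hfc.mono hboxI) hm
  have hφlim : Tendsto (fun lam => ENNReal.ofReal (5 * CS ^ 2 * (Kp * J lam) ^ (5 / 3 : ℝ))) (𝓝[>] 0)
      (𝓝 (ENNReal.ofReal (5 * CS ^ 2 * (Kp *
        ∫ p in Ioo (t₁ - ϱ' ^ 2) t₁ ×ˢ ball c ϱ', |f p.1 p.2| ^ (2 * m)
          ∂(volume : Measure (ℝ × EuclideanSpace ℝ (Fin 3)))) ^ (5 / 3 : ℝ)))) :=
    ENNReal.tendsto_ofReal (((hJlim.const_mul Kp).rpow_const (Or.inr (by norm_num))).const_mul _)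
  refine ge_of_tendsto hφlim ?_
  filter_upwards [self_mem_nhdsWithin] with lam hlam
  exact hstep lam hlam

/-- **The reverse Hölder inequality for the `η`-family, `L^{2m}`-norm form**: under the
hypotheses of `eta_reverseHolder_core`,
`∬_{Q_ϱ} |f|^{10m/3} ≤ ofReal (5 C_S² K′^{5/3}) · (∬_{Q_{ϱ'}} |f|^{2m})^{5/3}` with both sides as
extended nonnegative integrals. -/
theorem eta_reverseHolder_core_lintegral
    (hf : ∀ τ ∈ Ioo lo hi, ContDiff ℝ 2 (f τ)) (hfax : ∀ τ ∈ Ioo lo hi, IsAxisymmetricScalar (f τ))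
    (hW : ∀ τ ∈ Ioo lo hi, ContDiff ℝ 1 (W τ))
    {U : Set (EuclideanSpace ℝ (Fin 3))}
    (hdiv : ∀ τ ∈ Ioo lo hi, ∀ x ∈ U, VectorCalculus.divergence (W τ) x = 0)
    (hfc : ContinuousOn (fun p : ℝ × EuclideanSpace ℝ (Fin 3) => f p.1 p.2) (Ioo lo hi ×ˢ univ))
    (hDc : ContinuousOn (fun p : ℝ × EuclideanSpace ℝ (Fin 3) => fderiv ℝ (f p.1) p.2) (Ioo lo hi ×ˢ univ))
    (hqfc : ContinuousOn (fun p : ℝ × EuclideanSpace ℝ (Fin 3) => radDerivQuot (f p.1) p.2) (Ioo lo hi ×ˢ univ))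
    (hWc : ContinuousOn (fun p : ℝ × EuclideanSpace ℝ (Fin 3) => W p.1 p.2) (Ioo lo hi ×ˢ univ))
    (hLc : ContinuousOn (fun p : ℝ × EuclideanSpace ℝ (Fin 3) =>
      (Δ (f p.1)) p.2 - fderiv ℝ (f p.1) p.2 (W p.1 p.2) + 2 * radDerivQuot (f p.1) p.2) (Ioo lo hi ×ˢ univ))
    (heq : ∀ x ∈ U, ∀ s ∈ Ioo lo hi, ∀ t ∈ Ioo lo hi, s ≤ t →
      f t x - f s x = ∫ τ in s..t, ((Δ (f τ)) x - fderiv ℝ (f τ) x (W τ x) + 2 * radDerivQuot (f τ) x))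
    {c : EuclideanSpace ℝ (Fin 3)} (hc : c 0 = 0 ∧ c 1 = 0)
    {m : ℝ} (hm : 1 ≤ m) {R₂ ϱ ϱ' t₁ : ℝ} (hR₂ : 0 < R₂) (hϱ : R₂ / 2 ≤ ϱ) (hϱϱ' : ϱ < ϱ') (hϱ'R : ϱ' ≤ R₂)
    (hU : closedBall c ϱ' ⊆ U) (hlo : lo < t₁ - ϱ' ^ 2) (hhi : t₁ < hi)
    {CT : ℝ} (hCT : ∀ t, |deriv Real.smoothTransition t| ≤ CT)
    {C₁ : ℝ} (hC₁0 : 0 ≤ C₁) (hC₁ : ∀ (ρ₂ ρ₁ : ℝ), 0 ≤ ρ₂ → ρ₂ < ρ₁ → ∀ z : EuclideanSpace ℝ (Fin 3),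
      ‖gradient (radialCutoff ρ₂ ρ₁ : EuclideanSpace ℝ (Fin 3) → ℝ) z‖ ≤ C₁ / (ρ₁ - ρ₂))
    {wbar : ℝ} (hwbar : ∀ s ∈ Ioo (t₁ - ϱ' ^ 2) t₁, ∫ x in closedBall c ϱ', ‖W s x‖ ^ 2 ≤ wbar) :
    ∫⁻ p in Ioo (t₁ - ϱ ^ 2) t₁ ×ˢ ball c ϱ, ‖f p.1 p.2‖ₑ ^ (10 * m / 3 : ℝ)
        ∂(volume : Measure (ℝ × EuclideanSpace ℝ (Fin 3))) ≤
      ENNReal.ofReal (5 * (SNormLESNormFDerivOfEqConst ℝ (volume : Measure (EuclideanSpace ℝ (Fin 3))) 2 : ℝ) ^ 2 *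
        ((72 * C₁ ^ 2 + 68 * CT) / (ϱ' - ϱ) ^ 2 + 27648 * C₁ ^ 4 *
            (SNormLESNormFDerivOfEqConst ℝ (volume : Measure (EuclideanSpace ℝ (Fin 3))) 2 : ℝ) ^ 6 *
            wbar ^ 2 / (ϱ' - ϱ) ^ 4) ^ (5 / 3 : ℝ)) *
      (∫⁻ p in Ioo (t₁ - ϱ' ^ 2) t₁ ×ˢ ball c ϱ', ‖f p.1 p.2‖ₑ ^ (2 * m)
        ∂(volume : Measure (ℝ × EuclideanSpace ℝ (Fin 3)))) ^ (5 / 3 : ℝ) := by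
  have h := eta_reverseHolder_core hf hfax hW hdiv hfc hDc hqfc hWc hLc heq hc hm hR₂ hϱ hϱϱ' hϱ'R hU hlo hhi
    hCT hC₁0 hC₁ hwbar
  obtain ⟨Kp, hKp⟩ : ∃ Kp : ℝ, Kp = (72 * C₁ ^ 2 + 68 * CT) / (ϱ' - ϱ) ^ 2 + 27648 * C₁ ^ 4 *
      (SNormLESNormFDerivOfEqConst ℝ (volume : Measure (EuclideanSpace ℝ (Fin 3))) 2 : ℝ) ^ 6 *
      wbar ^ 2 / (ϱ' - ϱ) ^ 4 := ⟨_, rfl⟩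
  rw [← hKp] at h ⊢
  have hCT0 : 0 ≤ CT := (abs_nonneg _).trans (hCT 0)
  have hKp0 : 0 ≤ Kp := by rw [hKp]; positivity
  -- the real integral `∬ |f|^{2m}` as an extended integral
  have hboxI : Icc (t₁ - ϱ' ^ 2) t₁ ×ˢ closedBall c ϱ' ⊆ Ioo lo hi ×ˢ (univ : Set (EuclideanSpace ℝ (Fin 3))) :=
    prod_mono (fun r hr => ⟨hlo.trans_le hr.1, lt_of_le_of_lt hr.2 hhi⟩) (subset_univ _)
  have hQ'box : Ioo (t₁ - ϱ' ^ 2) t₁ ×ˢ ball c ϱ' ⊆ Icc (t₁ - ϱ' ^ 2) t₁ ×ˢ closedBall c ϱ' :=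
    prod_mono Ioo_subset_Icc_self ball_subset_closedBall
  have hcont : ContinuousOn (fun p : ℝ × EuclideanSpace ℝ (Fin 3) => |f p.1 p.2| ^ (2 * m))
      (Icc (t₁ - ϱ' ^ 2) t₁ ×ˢ closedBall c ϱ') :=
    ((hfc.mono hboxI).abs).rpow_const fun p _ => Or.inr (by linarith)
  have hint : IntegrableOn (fun p : ℝ × EuclideanSpace ℝ (Fin 3) => |f p.1 p.2| ^ (2 * m))
      (Ioo (t₁ - ϱ' ^ 2) t₁ ×ˢ ball c ϱ') (volume : Measure (ℝ × EuclideanSpace ℝ (Fin 3))) :=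
    (hcont.integrableOn_compact (isCompact_Icc.prod (isCompact_closedBall _ _))).mono_set hQ'box
  have hI0 : 0 ≤ ∫ p in Ioo (t₁ - ϱ' ^ 2) t₁ ×ˢ ball c ϱ', |f p.1 p.2| ^ (2 * m)
      ∂(volume : Measure (ℝ × EuclideanSpace ℝ (Fin 3))) :=
    setIntegral_nonneg (measurableSet_Ioo.prod measurableSet_ball) fun p _ =>
      Real.rpow_nonneg (abs_nonneg _) _
  have eI : ENNReal.ofReal (∫ p in Ioo (t₁ - ϱ' ^ 2) t₁ ×ˢ ball c ϱ', |f p.1 p.2| ^ (2 * m)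
      ∂(volume : Measure (ℝ × EuclideanSpace ℝ (Fin 3)))) =
      ∫⁻ p in Ioo (t₁ - ϱ' ^ 2) t₁ ×ˢ ball c ϱ', ‖f p.1 p.2‖ₑ ^ (2 * m)
        ∂(volume : Measure (ℝ × EuclideanSpace ℝ (Fin 3))) := by
    rw [ofReal_integral_eq_lintegral_ofReal hint (ae_of_all _ fun p => Real.rpow_nonneg (abs_nonneg _) _)]
    refine lintegral_congr fun p => ?_
    rw [Real.enorm_eq_ofReal_abs, ENNReal.ofReal_rpow_of_nonneg (abs_nonneg _) (by linarith)]
  refine h.trans (le_of_eq ?_)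
  rw [← eI, ENNReal.ofReal_rpow_of_nonneg hI0 (by norm_num), ← ENNReal.ofReal_mul (by positivity),
    Real.mul_rpow hKp0 hI0]
  congr 1
  ring

end Core

end

end Summit.NavierStokesRegularity.NavierStokesRegularity.Theorems.SwirlFreeBudget
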